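import Literature.Algebra.EuclideanLattices.BallGridPointsOverlap
import Literature.Combinatorics.Enumerative.BoxBoundaryCount
import HarnessLib

/-!
# Regev 2004, Claim 3.14: the counting inequality behind the failure probability of one register

Topic `Algebra/EuclideanLattices` (family `pqc`). Proved material (no named fact) towards the named
fact `Literature.Algebra.EuclideanLattices.usvp_of_dihedralCoset` (Regev 2004, Thm. 1.1).

Claim 3.14 (p. 15): "With probability at least `1 − 1/(n log 2M)^f`, for randomly chosen `t` and `ā`
and a random point `x̄'` in `f(t, ā) + (1/L)ℤⁿ ∩ Bₙ`, `ā'` is in `A` and `x̄'` is also in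
`f(1 − t, ā') + (1/L)ℤⁿ ∩ Bₙ`."  Its proof has two factors: (a) `ā' = ā ± w̄` (`w̄` the coefficient
difference of Claim 3.13, `|wᵢ| ≤ K = 2^{2n}` by Lemma 3.3) leaves the box `A = [0, M)ⁿ` only if `ā`
is within `K` of the boundary in some coordinate — probability `≤ 2nK/M` (`n 2^{2n+1}/M`); (b) for
fixed good `ā`, `x̄' = f(t,ā) + z̄` is in `f(1−t, ā') + D` iff `z̄ ∈ D ∩ (D ± ū)` (`D` the grid points of
the ball, `f(1−t,ā') − f(t,ā) = ±ū`), probability `≥ 1 − O(√n ‖ū‖/R)` by Corollary 3.9.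

Here, in the integer normalisation used by the circuit (grid `ℤⁿ`, ball radius `T`), the claim is the
COUNTING inequality, for each sign `σ = ±1`:

  `(1 − 2nK/M − (√n ‖ū‖/T + 3n^{1.5}/T)) · Mⁿ · #(ℤⁿ ∩ B̄(0,T))`
  `   ≤ #{ā ∈ [0,M)ⁿ : ā + σ w̄ ∈ [0,M)ⁿ} · #(ℤⁿ ∩ B̄(0,T) ∩ B̄(σ ū, T))`

(`Regev2004.sub_mul_le_card_goodBox_mul_card_inter`), from `card_nearBoundary_le`
(`Combinatorics/Enumerative/BoxBoundaryCount.lean`) and Corollary 3.9 for `ℤⁿ`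
(`sub_mul_card_intGrid_le_card_inter`, `BallGridPointsOverlap.lean`); the two factors separately are
`Regev2004.card_box_sub_le_card_goodBox` and Corollary 3.9.  Turning counts into the probability of the
uniform law, summing over `t`, and comparing with `1/(n log 2M)^f` is left to the assembly.

## References

* O. Regev, *Quantum computation and lattice problems*, SIAM J. Comput. 33 (2004) 738–760,
  Claim 3.14 and its proof (p. 15) [Regev2004].
-/

noncomputable section

open Metric Finset

namespace Literature.Algebra.EuclideanLattices

open Literature.Combinatorics.Enumerative

variable {n : ℕ}

/-- The points `ā` of the box `[0, M)ⁿ` whose shift `ā + σ w̄` stays in the box. [cite: Regev2004, Claim 3.14 (proof)] -/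
def goodBox (n M : ℕ) (σ : ℤ) (w : Fin n → ℤ) : Finset (Fin n → Fin M) :=
  univ.filter fun a => ∀ i, 0 ≤ (a i : ℤ) + σ * w i ∧ (a i : ℤ) + σ * w i < M

/-- **Factor (a) of Claim 3.14.** If `|wᵢ| ≤ K` and `|σ| ≤ 1` then every `ā ∈ [0,M)ⁿ` with no coordinate
within `K` of the boundary has `ā + σ w̄ ∈ [0,M)ⁿ`; hence
`#{ā : ā + σ w̄ ∈ box} ≥ Mⁿ − n · 2K · Mⁿ⁻¹`. [cite: Regev2004, Claim 3.14 (proof, p. 15)] -/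
theorem Regev2004.card_box_sub_le_card_goodBox (n M K : ℕ) {σ : ℤ} (hσ : |σ| ≤ 1) {w : Fin n → ℤ}
    (hw : ∀ i, |w i| ≤ K) :
    M ^ n - n * (2 * K) * M ^ (n - 1) ≤ (goodBox n M σ w).card := by
  classical
  -- the complement of `goodBox` lies in the near-boundary set
  have hsub : (goodBox n M σ w)ᶜ ⊆ (univ : Finset (Fin n → Fin M)).filter
      fun a => ∃ i, ((a i : ℕ) < K ∨ M ≤ (a i : ℕ) + K) := by
    intro a ha
    rw [mem_compl, goodBox, mem_filter, not_and] at ha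
    have ha' := ha (mem_univ a)
    push Not at ha'
    obtain ⟨i, hi⟩ := ha'
    simp only [mem_filter, mem_univ, true_and]
    refine ⟨i, ?_⟩
    by_contra hcon
    push Not at hcon
    obtain ⟨h1, h2⟩ := hcon
    have hσw : |σ * w i| ≤ K := by
      rw [abs_mul]
      calc |σ| * |w i| ≤ 1 * K := mul_le_mul hσ (hw i) (abs_nonneg _) zero_le_one
        _ = K := one_mul _
    obtain ⟨hlo, hhi⟩ := abs_le.1 hσw
    have h1' : (K : ℤ) ≤ ((a i : ℕ) : ℤ) := by exact_mod_cast h1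
    have h2' : ((a i : ℕ) : ℤ) + K < M := by exact_mod_cast h2
    have hx0 : 0 ≤ ((a i : ℕ) : ℤ) + σ * w i := by linarith
    have hxM : ((a i : ℕ) : ℤ) + σ * w i < M := by linarith
    exact absurd hxM (not_lt.2 (hi hx0))
  have hcompl := card_le_card hsub
  have hnb := card_nearBoundary_le n M K
  have htot : (goodBox n M σ w).card + (goodBox n M σ w)ᶜ.card = M ^ n := by
    rw [card_add_card_compl, Fintype.card_fun, Fintype.card_fin, Fintype.card_fin]
  omega

/-- **Regev 2004, Claim 3.14, as a counting inequality** (one value of `t`, sign `σ = ±1`): for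
`n ≥ 2`, `T > 0`, `|wᵢ| ≤ K`, and any `ū ∈ ℝⁿ`,
`(1 − 2nK/M − (√n ‖ū‖/T + 3n^{1.5}/T)) · Mⁿ · #(ℤⁿ ∩ B̄(0,T)) ≤ #goodBox · #(ℤⁿ ∩ B̄(0,T) ∩ B̄(σū,T))`.
[cite: Regev2004, Claim 3.14 (proof, p. 15)] -/
theorem Regev2004.sub_mul_le_card_goodBox_mul_card_inter (hn : 2 ≤ n) {T : ℝ} (hT : 0 < T)
    (M K : ℕ) {σ : ℤ} (hσ : |σ| ≤ 1) {w : Fin n → ℤ} (hw : ∀ i, |w i| ≤ K)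
    (u : EuclideanSpace ℝ (Fin n)) :
    (1 - 2 * n * K / M - (Real.sqrt n * ‖u‖ / T + 3 * n * Real.sqrt n / T)) *
        ((M : ℝ) ^ n * Nat.card (closedBall (0 : EuclideanSpace ℝ (Fin n)) T ∩ scaledGrid n 1 :
          Set (EuclideanSpace ℝ (Fin n)))) ≤
      (goodBox n M σ w).card *
        Nat.card ((closedBall (0 : EuclideanSpace ℝ (Fin n)) T ∩ closedBall ((σ : ℝ) • u) T) ∩
          scaledGrid n 1 : Set (EuclideanSpace ℝ (Fin n))) := by
  set NB : ℝ := (Nat.card (closedBall (0 : EuclideanSpace ℝ (Fin n)) T ∩ scaledGrid n 1 :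
    Set (EuclideanSpace ℝ (Fin n))) : ℝ) with hNB
  set NS : ℝ := (Nat.card ((closedBall (0 : EuclideanSpace ℝ (Fin n)) T ∩
    closedBall ((σ : ℝ) • u) T) ∩ scaledGrid n 1 : Set (EuclideanSpace ℝ (Fin n))) : ℝ) with hNS
  set G : ℝ := ((goodBox n M σ w).card : ℝ) with hG
  set α : ℝ := 2 * n * K / M with hα
  set β : ℝ := Real.sqrt n * ‖u‖ / T + 3 * n * Real.sqrt n / T with hβ
  have hNB0 : 0 ≤ NB := Nat.cast_nonneg _
  have hNS0 : 0 ≤ NS := Nat.cast_nonneg _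
  have hG0 : 0 ≤ G := Nat.cast_nonneg _
  have hMn0 : 0 ≤ (M : ℝ) ^ n := by positivity
  -- factor (b): Corollary 3.9 for `ℤⁿ`, with `‖σ • u‖ ≤ ‖u‖`
  have hb : (1 - β) * NB ≤ NS := by
    have h39 := sub_mul_card_intGrid_le_card_inter n hn hT ((σ : ℝ) • u)
    have hnorm : ‖(σ : ℝ) • u‖ ≤ ‖u‖ := by
      rw [norm_smul]
      have : ‖(σ : ℝ)‖ ≤ 1 := by
        rw [Real.norm_eq_abs]; exact_mod_cast hσ
      exact mul_le_of_le_one_left (norm_nonneg _) this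
    have hmono : 1 - β ≤ 1 - Real.sqrt n * ‖(σ : ℝ) • u‖ / T - 3 * n * Real.sqrt n / T := by
      rw [hβ]
      have : Real.sqrt n * ‖(σ : ℝ) • u‖ / T ≤ Real.sqrt n * ‖u‖ / T := by gcongr
      linarith
    exact (mul_le_mul_of_nonneg_right hmono hNB0).trans h39
  -- factor (a): the box
  have ha : (1 - α) * (M : ℝ) ^ n ≤ G := by
    have h1 := Regev2004.card_box_sub_le_card_goodBox n M K hσ hw
    have h2 : ((M ^ n - n * (2 * K) * M ^ (n - 1) : ℕ) : ℝ) ≤ G := by rw [hG]; exact_mod_cast h1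
    rcases Nat.eq_zero_or_pos M with hM | hM
    · -- `M = 0`: the box is empty (as `n ≥ 1`)
      subst hM
      have hn0 : n ≠ 0 := by omega
      simpa [zero_pow hn0] using hG0
    · have hMpos : (0 : ℝ) < M := by exact_mod_cast hM
      have e : (1 - α) * (M : ℝ) ^ n = (M : ℝ) ^ n - n * (2 * K) * (M : ℝ) ^ (n - 1) := by
        rw [hα]
        obtain ⟨k, rfl⟩ : ∃ k, n = k + 1 := ⟨n - 1, by omega⟩
        rw [Nat.add_sub_cancel, pow_succ]
        field_simp
      have hcast : (M : ℝ) ^ n - n * (2 * K) * (M : ℝ) ^ (n - 1) ≤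
          ((M ^ n - n * (2 * K) * M ^ (n - 1) : ℕ) : ℝ) := by
        rcases le_or_gt (n * (2 * K) * M ^ (n - 1)) (M ^ n) with h | h
        · rw [Nat.cast_sub h]; push_cast; exact le_rfl
        · rw [Nat.sub_eq_zero_of_le h.le]
          have : ((M ^ n : ℕ) : ℝ) < ((n * (2 * K) * M ^ (n - 1) : ℕ) : ℝ) := by exact_mod_cast h
          push_cast at this ⊢
          linarith
      rw [e]
      exact hcast.trans h2
  -- combine
  rcases le_or_gt (1 - α - β) 0 with htriv | hpos
  · calc (1 - α - β) * ((M : ℝ) ^ n * NB) ≤ 0 := mul_nonpos_of_nonpos_of_nonneg htriv (by positivity)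
      _ ≤ G * NS := mul_nonneg hG0 hNS0
  · have hα0 : 0 ≤ α := by positivity
    have hβ0 : 0 ≤ β := by positivity
    have h1b : 0 ≤ 1 - β := by linarith
    have hprod : 1 - α - β ≤ (1 - α) * (1 - β) := by nlinarith [mul_nonneg hα0 hβ0]
    calc (1 - α - β) * ((M : ℝ) ^ n * NB) ≤ ((1 - α) * (1 - β)) * ((M : ℝ) ^ n * NB) :=
          mul_le_mul_of_nonneg_right hprod (by positivity)
      _ = ((1 - α) * (M : ℝ) ^ n) * ((1 - β) * NB) := by ring
      _ ≤ G * NS := mul_le_mul ha hb (mul_nonneg h1b hNB0) hG0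

end Literature.Algebra.EuclideanLattices
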